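import Literature.Topology.FourManifolds.KnotGroupMulEquivProofs
import Literature.AlgebraicTopology.FundamentalGroup.CircleAndTorus
import HarnessLib

/-!
# The Alexander polynomial is an isotopy invariant and a mirror-image invariant

Sibling proof file of `Literature.Topology.FourManifolds.KnotGroup` (D-0014). It discharges the
named facts

* `Literature.Topology.FourManifolds.Knot.IsAlexanderPolynomial.of_isIsotopic`: if the knots
  `K, K' : S¹ ↪ S³` are isotopic (`Knot.IsIsotopic`, i.e. ambient isotopic: `K' = F₁ ∘ K` for an
  ambient isotopy `F` of `S³`) and `Δ` is an Alexander polynomial of `K`, then `Δ` is an Alexander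
  polynomial of `K'` (`IsAlexanderPolynomial.of_isIsotopic_holds`);
* `Literature.Topology.FourManifolds.Knot.IsAlexanderPolynomial.mirror`: the mirror image
  `K.mirror = r ∘ K` (`r` the reflection of `S³` in its last coordinate) has the same Alexander
  polynomials as `K` (`IsAlexanderPolynomial.mirror_holds`).

Both are instances of one lemma, `Knot.IsAlexanderPolynomial.of_homeomorph_comp`: if
`Φ : S³ ≃ₜ S³` is a homeomorphism with `Φ ∘ K = K'`, then `Φ` maps `range K` onto
`range K' = Φ '' range K`, hence restricts to a homeomorphism of the complements
`S³ ∖ K ≃ₜ S³ ∖ K'` (Mathlib `Homeomorph.subtype`); a based homeomorphism induces an isomorphism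
of fundamental groups `π₁(S³ ∖ K, x) ≃* π₁(S³ ∖ K', Φ x)`
(`Literature.AlgebraicTopology.FundamentalGroup.fundamentalGroupEquivOfHomeomorph`, Hatcher
Prop. 1.18), and Alexander polynomials are invariant under group isomorphisms
(`IsAlexanderPolynomial.of_mulEquiv_holds`, `KnotGroupMulEquivProofs.lean`; Crowell–Fox Ch. VIII
(3.4), "invariance of the knot polynomials"). For the isotopy `Φ = F₁` is the stage-one
diffeomorphism (`AmbientIsotopy.toDiffeomorph`); for the mirror image `Φ = r`, an involutive
homeomorphism (`reflectLast_reflectLast`, `continuous_reflectLast`).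

## References

* D. Rolfsen, *Knots and Links*, Publish or Perish 1976, §3.A (the knot group is an invariant of
  the knot type), §3.C (mirror images), §7.C, §8.C Exercise 8.C.10.
* R. H. Crowell, R. H. Fox, *Introduction to Knot Theory*, 1963, Ch. VIII (3.4)–(3.5), Ch. IX §2.
* A. Hatcher, *Algebraic Topology*, CUP 2002, Prop. 1.18.
-/

open scoped Manifold ContDiff Topology LaurentPolynomial
open Function Set

noncomputable section

namespace Literature.Topology.FourManifolds

namespace Knot

/-- **A homeomorphism of `S³` carrying `K` to `K'` carries the complement of `K` onto the
complement of `K'`**: `p ∉ range K ↔ Φ p ∉ range K'` when `Φ ∘ K = K'`, since then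
`range K' = Φ '' range K` (Rolfsen 1976, §3.A: equivalent knots have homeomorphic complements).
[cite: Rolfsen1976, §3.A] -/
theorem mem_complement_iff_of_homeomorph_comp {K K' : Knot}
    (Φ : (Metric.sphere (0 : EuclideanSpace ℝ (Fin (3 + 1))) 1) ≃ₜ
      (Metric.sphere (0 : EuclideanSpace ℝ (Fin (3 + 1))) 1))
    (hΦ : ⇑Φ ∘ ⇑K = ⇑K') (p : (Metric.sphere (0 : EuclideanSpace ℝ (Fin (3 + 1))) 1)) :
    p ∈ K.complement ↔ Φ p ∈ K'.complement := by
  rw [SphereEmbedding.mem_complement_iff, SphereEmbedding.mem_complement_iff, ← hΦ, Set.range_comp,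
    Φ.injective.mem_set_image]

/-- **Alexander polynomials are invariant under homeomorphisms of `S³` carrying one knot to the
other.** If `Φ : S³ ≃ₜ S³` satisfies `Φ ∘ K = K'`, then every Alexander polynomial of `K` is one of
`K'`: `Φ` restricts to a homeomorphism of complements (`mem_complement_iff_of_homeomorph_comp`,
Mathlib `Homeomorph.subtype`), which induces an isomorphism of knot groups
(`fundamentalGroupEquivOfHomeomorph`, Hatcher Prop. 1.18), and Alexander polynomials only depend
on the isomorphism class of the group (`IsAlexanderPolynomial.of_mulEquiv_holds`, Crowell–Fox
Ch. VIII (3.4)). [cite: CrowellFox1963, Ch. VIII (3.4)–(3.5)] [cite: HatcherAT2002, Prop. 1.18] -/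
theorem IsAlexanderPolynomial.of_homeomorph_comp {K K' : Knot}
    (Φ : (Metric.sphere (0 : EuclideanSpace ℝ (Fin (3 + 1))) 1) ≃ₜ
      (Metric.sphere (0 : EuclideanSpace ℝ (Fin (3 + 1))) 1))
    (hΦ : ⇑Φ ∘ ⇑K = ⇑K') {Δ : ℤ[T;T⁻¹]} (h : K.IsAlexanderPolynomial Δ) :
    K'.IsAlexanderPolynomial Δ := by
  obtain ⟨x, hx⟩ := h
  let e : K.complement ≃ₜ K'.complement := Φ.subtype (mem_complement_iff_of_homeomorph_comp Φ hΦ)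
  exact ⟨e x, IsAlexanderPolynomial.of_mulEquiv_holds hx
    (Literature.AlgebraicTopology.FundamentalGroup.fundamentalGroupEquivOfHomeomorph e rfl)⟩

/-- **Discharge of `Knot.IsAlexanderPolynomial.of_isIsotopic`: the Alexander polynomial is an
isotopy invariant.** An ambient isotopy `F` with `F₁ ∘ K = K'` provides the homeomorphism
`Φ = F₁` of `S³` (`AmbientIsotopy.toDiffeomorph`), and `IsAlexanderPolynomial.of_homeomorph_comp`
applies. Rolfsen (1976), §3.A, §7.C; Crowell–Fox (1963), Ch. VIII (3.5). [cite: Rolfsen1976, §3.A, §7.C] [cite: CrowellFox1963, Ch. VIII (3.4)–(3.5)] -/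
theorem IsAlexanderPolynomial.of_isIsotopic_holds : IsAlexanderPolynomial.of_isIsotopic := by
  intro K K' Δ hiso hK
  obtain ⟨F, hF⟩ := hiso
  exact IsAlexanderPolynomial.of_homeomorph_comp (F.toDiffeomorph 1).toHomeomorph hF hK

/-- **Isotopic knots have the same Alexander polynomials** (unconditional form of
`isAlexanderPolynomial_congr_of_isIsotopic`, fed with `IsAlexanderPolynomial.of_isIsotopic_holds`;
symmetry of isotopy is still taken from `[SphereEmbedding.IsotopyFacts 1 3]`). Rolfsen (1976),
§3.A, §7.C. [cite: Rolfsen1976, §3.A, §7.C] -/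
theorem isAlexanderPolynomial_congr_of_isIsotopic' [SphereEmbedding.IsotopyFacts 1 3]
    {K K' : Knot} (hKK' : K.IsIsotopic K') (Δ : ℤ[T;T⁻¹]) :
    K.IsAlexanderPolynomial Δ ↔ K'.IsAlexanderPolynomial Δ :=
  isAlexanderPolynomial_congr_of_isIsotopic IsAlexanderPolynomial.of_isIsotopic_holds hKK' Δ

/-- **Having trivial Alexander polynomial is an isotopy invariant** (unconditional form of
`HasTrivialAlexanderPolynomial.of_isIsotopic`). Rolfsen (1976), §3.A, §7.C. [cite: Rolfsen1976, §3.A, §7.C] -/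
theorem HasTrivialAlexanderPolynomial.of_isIsotopic' {K K' : Knot} (hKK' : K.IsIsotopic K')
    (h : K.HasTrivialAlexanderPolynomial) : K'.HasTrivialAlexanderPolynomial :=
  HasTrivialAlexanderPolynomial.of_isIsotopic IsAlexanderPolynomial.of_isIsotopic_holds hKK' h

section Mirror

/-! ### Mirror images

The mirror knot `K.mirror` is only defined under the fact class `[SphereEmbedding.SmoothnessFacts]`
(smoothness of the reflected embedding), exactly as in the statement of the named fact
`Knot.IsAlexanderPolynomial.mirror`; the class is a section variable here. -/

variable [SphereEmbedding.SmoothnessFacts]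

/-- **Discharge of `Knot.IsAlexanderPolynomial.mirror`: the mirror image of a knot has the same
Alexander polynomials.** The reflection `r` of `S³` in its last coordinate is an involutive
homeomorphism (`reflectLast_reflectLast`, `continuous_reflectLast`) with `r ∘ K = K.mirror`
(`SphereEmbedding.coe_mirror`), and `IsAlexanderPolynomial.of_homeomorph_comp` applies
(classically `Δ_{mirror K}(t) = Δ_K(t⁻¹) ≐ Δ_K(t)`). Rolfsen (1976), §3.C, §8.C Exercise 8.C.10;
Crowell–Fox (1963), Ch. IX §2. [cite: Rolfsen1976, §3.C, Exercise 8.C.10] -/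
theorem IsAlexanderPolynomial.mirror_holds : IsAlexanderPolynomial.mirror := by
  intro K Δ hK
  let r : (Metric.sphere (0 : EuclideanSpace ℝ (Fin (3 + 1))) 1) ≃ₜ
      (Metric.sphere (0 : EuclideanSpace ℝ (Fin (3 + 1))) 1) :=
    { toFun := reflectLast 3
      invFun := reflectLast 3
      left_inv := reflectLast_reflectLast 3
      right_inv := reflectLast_reflectLast 3
      continuous_toFun := continuous_reflectLast 3
      continuous_invFun := continuous_reflectLast 3 }
  exact IsAlexanderPolynomial.of_homeomorph_comp r (SphereEmbedding.coe_mirror K).symm hK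

/-- **The mirror image has the same Alexander polynomials, as an `iff`** (`K.mirror.mirror = K`,
`SphereEmbedding.mirror_mirror`). Rolfsen (1976), §3.C. [cite: Rolfsen1976, §3.C, Exercise 8.C.10] -/
theorem isAlexanderPolynomial_mirror_iff (K : Knot) (Δ : ℤ[T;T⁻¹]) : K.mirror.IsAlexanderPolynomial Δ ↔ K.IsAlexanderPolynomial Δ := by
  refine ⟨fun h => ?_, fun h => IsAlexanderPolynomial.mirror_holds h⟩
  have h2 : Knot.IsAlexanderPolynomial (SphereEmbedding.mirror (SphereEmbedding.mirror K)) Δ :=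
    IsAlexanderPolynomial.mirror_holds h
  rwa [SphereEmbedding.mirror_mirror] at h2

end Mirror

end Knot

end Literature.Topology.FourManifolds

end
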